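import Mathlib
import Literature.Analysis.FluidPDE.AxisymmetricEuler
import Literature.Analysis.FluidPDE.AxisymmetricVorticityTransport
import Literature.Analysis.FluidPDE.KNSSTypeIRateSelection
import Literature.Analysis.FluidPDE.VectorCalculus
import HarnessLib

/-!
# Census row A8t, line «pitch-defect»: calculus of columnar swirl–axial fields (stub S3a2, part 1)

Support file for the scenario census of `NavierStokesRegularity` (row A8t, line «pitch-defect»,
stub S3a2 `stub_columnarOseenInvisible` = «columnar swirl–axial fields are Oseen-invisible»;
KEY-NS #101 (2)). A **columnar** field on `ℝ³` is a `C¹` divergence-free field `Z` which is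
independent of `x₃` (`Z(y + s e₃) = Z(y)`) and equivariant under the rotations about the `x₃`-axis
(`Z(R_θ y) = R_θ Z(y)`). This file proves, without cylindrical coordinates beyond the half-plane
`{x₂ = 0}`, the pointwise structure of such fields that makes their Navier–Stokes self-interaction
a pure pressure:

* `Columnar.fderiv_e3` — `∂₃ Z = 0`; `Columnar.fderiv_rotGen` — differentiating the equivariance,
  `DZ(y)[Jy] = J Z(y)` with `Jy = (−y₂, y₁, 0)` the rotation generator;
* `Columnar.radial_eq_zero` — **no radial part**: `Z₁(r, 0, z) = 0` for all `r, z` (the function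
  `r ↦ r Z₁(r,0,z)` has derivative `Z₁ + r∂₁Z₁ = Z₁ − r∂₂Z₂ − r∂₃Z₃ = Z₁ − Z₁ − 0 = 0` by
  `div Z = 0`, `∂₃Z = 0` and `r∂₂Z₂ = Z₁` from the generator identity, and vanishes at `r = 0`);
* `Columnar.convect_halfPlane` — on the half-plane the self-convection is CENTRIPETAL:
  `DZ(y)[Z(y)] = −(Z₂(y)²/r) e₁` at `y = (r, 0, z)`, `r ≠ 0`;
* `Columnar.convect_rotZ`, `Columnar.convect_formula` — by equivariance, for every `y` off the axis
  `DZ(y)[Z(y)] = −(m(y)/r²) y_h` with `m(y) = Z₂(r e₁)²`, `r = |y_h|`, and `DZ(y)[Z(y)] = 0` on the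
  axis;

Part 2 (`ScenarioCensusPitchDefectColumnarPairing.lean`) builds the radial potential `Φ` with
`DZ[Z] = −∇Φ` and integrates by parts twice against a divergence-free, rapidly decaying field to
conclude that the Oseen bilinear term of a columnar field annihilates solenoidal tests. No summit
statement and no census row is proved here.
-/

-- the summit and its single problem share the name (D-0017 nested layout)
set_option linter.dupNamespace false

noncomputable section

open MeasureTheory Set Function Filter Metric intervalIntegral
open scoped Topology ENNReal NNReal RealInnerProductSpace

namespace Summit.NavierStokesRegularity.NavierStokesRegularity.Theorems.ScenarioCensus.PitchDefect

open Literature.Analysis Literature.Analysis.FluidPDE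

namespace Columnar

/-! ### Frame vectors and the rotation generator -/

/-- Components of `EuclideanSpace.single`. [folklore] -/
theorem single_apply' (i j : Fin 3) (a : ℝ) :
    (EuclideanSpace.single i a : (EuclideanSpace ℝ (Fin 3))) j = if j = i then a else 0 := by
  simp

/-- The rotation `R_θ y` as a trigonometric combination of the horizontal part, its quarter turn
and the axial part: `R_θ y = cos θ (y₁,y₂,0) + sin θ (−y₂,y₁,0) + (0,0,y₃)`. [folklore] -/
theorem rotZ_eq_trig (θ : ℝ) (y : (EuclideanSpace ℝ (Fin 3))) :
    rotZ θ y = Real.cos θ • ((y 0) • EuclideanSpace.single 0 (1 : ℝ) + (y 1) • EuclideanSpace.single 1 (1 : ℝ)) +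
      Real.sin θ • ((-(y 1)) • EuclideanSpace.single 0 (1 : ℝ) + (y 0) • EuclideanSpace.single 1 (1 : ℝ)) +
      (y 2) • EuclideanSpace.single 2 (1 : ℝ) := by
  ext i
  fin_cases i <;> simp [rotZ] <;> ring

/-- The derivative of the rotation orbit at `θ = 0` is the generator `Jy = (−y₂, y₁, 0)`. [folklore] -/
theorem hasDerivAt_rotZ_zero (y : (EuclideanSpace ℝ (Fin 3))) :
    HasDerivAt (fun θ : ℝ => rotZ θ y)
      ((-(y 1)) • EuclideanSpace.single 0 (1 : ℝ) + (y 0) • EuclideanSpace.single 1 (1 : ℝ)) 0 := by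
  have h : HasDerivAt (fun θ : ℝ =>
      Real.cos θ • ((y 0) • EuclideanSpace.single 0 (1 : ℝ) + (y 1) • EuclideanSpace.single 1 (1 : ℝ)) +
      Real.sin θ • ((-(y 1)) • EuclideanSpace.single 0 (1 : ℝ) + (y 0) • EuclideanSpace.single 1 (1 : ℝ)) +
      (y 2) • (EuclideanSpace.single 2 (1 : ℝ) : (EuclideanSpace ℝ (Fin 3))))
      ((-Real.sin 0) • ((y 0) • EuclideanSpace.single 0 (1 : ℝ) + (y 1) • EuclideanSpace.single 1 (1 : ℝ)) +
        Real.cos 0 • ((-(y 1)) • EuclideanSpace.single 0 (1 : ℝ) + (y 0) • EuclideanSpace.single 1 (1 : ℝ))) 0 :=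
    (((Real.hasDerivAt_cos 0).smul_const _).add ((Real.hasDerivAt_sin 0).smul_const _)).add_const _
  rw [Real.sin_zero, Real.cos_zero, neg_zero, zero_smul, zero_add, one_smul] at h
  refine h.congr_of_eventuallyEq (Eventually.of_forall fun θ => ?_)
  exact rotZ_eq_trig θ y

variable {Z : (EuclideanSpace ℝ (Fin 3)) → (EuclideanSpace ℝ (Fin 3))}

/-! ### First-order consequences of the symmetries -/

/-- **On the axis a rotation-equivariant field is axial**: its horizontal components vanish
(apply the half turn). [folklore] -/
theorem horizontal_eq_zero_of_axis (hrot : ∀ (θ : ℝ) (y : (EuclideanSpace ℝ (Fin 3))), Z (rotZ θ y) = rotZ θ (Z y))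
    {y : (EuclideanSpace ℝ (Fin 3))} (h0 : y 0 = 0) (h1 : y 1 = 0) : Z y 0 = 0 ∧ Z y 1 = 0 := by
  have hfix : rotZ Real.pi y = y := by
    ext i; fin_cases i <;> simp [rotZ, h0, h1]
  have key := hrot Real.pi y
  rw [hfix] at key
  have e0 := congrArg (fun v : (EuclideanSpace ℝ (Fin 3)) => v 0) key
  have e1 := congrArg (fun v : (EuclideanSpace ℝ (Fin 3)) => v 1) key
  simp only [rotZ_apply_zero, rotZ_apply_one, Real.cos_pi, Real.sin_pi] at e0 e1
  constructor <;> linarith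

/-- **`∂₃ Z = 0`** for a field independent of `x₃`. [folklore] -/
theorem fderiv_e3 (hZ : Differentiable ℝ Z)
    (hz : ∀ (s : ℝ) (y : (EuclideanSpace ℝ (Fin 3))), Z (y + s • EuclideanSpace.single 2 (1 : ℝ)) = Z y) (y : (EuclideanSpace ℝ (Fin 3))) :
    fderiv ℝ Z y (EuclideanSpace.single 2 (1 : ℝ)) = 0 := by
  -- the curve `s ↦ Z (y + s e₃)` is constant
  have hcurve : HasDerivAt (fun s : ℝ => y + s • (EuclideanSpace.single 2 (1 : ℝ) : (EuclideanSpace ℝ (Fin 3))))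
      (EuclideanSpace.single 2 (1 : ℝ)) 0 := by
    have h := ((hasDerivAt_id (0 : ℝ)).smul_const (EuclideanSpace.single 2 (1 : ℝ) : (EuclideanSpace ℝ (Fin 3)))).const_add y
    simpa using h
  have h1 : HasDerivAt (fun s : ℝ => Z (y + s • (EuclideanSpace.single 2 (1 : ℝ) : (EuclideanSpace ℝ (Fin 3)))))
      (fderiv ℝ Z y (EuclideanSpace.single 2 (1 : ℝ))) 0 := by
    have h : HasDerivAt (fun s : ℝ => Z (y + s • (EuclideanSpace.single 2 (1 : ℝ) : (EuclideanSpace ℝ (Fin 3)))))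
        (fderiv ℝ Z (y + (0 : ℝ) • (EuclideanSpace.single 2 (1 : ℝ) : (EuclideanSpace ℝ (Fin 3)))) (EuclideanSpace.single 2 (1 : ℝ))) 0 :=
      (hZ (y + (0 : ℝ) • (EuclideanSpace.single 2 (1 : ℝ) : (EuclideanSpace ℝ (Fin 3))))).hasFDerivAt.comp_hasDerivAt
        (0 : ℝ) hcurve
    rw [zero_smul, add_zero] at h
    exact h
  have h2 : HasDerivAt (fun s : ℝ => Z (y + s • (EuclideanSpace.single 2 (1 : ℝ) : (EuclideanSpace ℝ (Fin 3))))) 0 0 := by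
    have e : (fun s : ℝ => Z (y + s • (EuclideanSpace.single 2 (1 : ℝ) : (EuclideanSpace ℝ (Fin 3))))) = fun _ => Z y :=
      funext fun s => hz s y
    rw [e]
    exact hasDerivAt_const _ _
  exact h1.unique h2

/-- **The generator identity**: differentiating `Z(R_θ y) = R_θ Z(y)` at `θ = 0`,
`DZ(y)[Jy] = J(Z y)` with `Jv = (−v₂, v₁, 0)`. [folklore] -/
theorem fderiv_rotGen (hZ : Differentiable ℝ Z)
    (hrot : ∀ (θ : ℝ) (y : (EuclideanSpace ℝ (Fin 3))), Z (rotZ θ y) = rotZ θ (Z y)) (y : (EuclideanSpace ℝ (Fin 3))) :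
    fderiv ℝ Z y ((-(y 1)) • EuclideanSpace.single 0 (1 : ℝ) + (y 0) • EuclideanSpace.single 1 (1 : ℝ)) =
      (-(Z y 1)) • EuclideanSpace.single 0 (1 : ℝ) + (Z y 0) • EuclideanSpace.single 1 (1 : ℝ) := by
  have h1 : HasDerivAt (fun θ : ℝ => Z (rotZ θ y))
      (fderiv ℝ Z y ((-(y 1)) • EuclideanSpace.single 0 (1 : ℝ) + (y 0) • EuclideanSpace.single 1 (1 : ℝ)))
      0 := by
    have h := (hZ (rotZ 0 y)).hasFDerivAt.comp_hasDerivAt (0 : ℝ) (hasDerivAt_rotZ_zero y)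
    rw [rotZ_zero] at h
    exact h
  have h2 : HasDerivAt (fun θ : ℝ => Z (rotZ θ y))
      ((-(Z y 1)) • EuclideanSpace.single 0 (1 : ℝ) + (Z y 0) • EuclideanSpace.single 1 (1 : ℝ)) 0 := by
    have e : (fun θ : ℝ => Z (rotZ θ y)) = fun θ => rotZ θ (Z y) := funext fun θ => hrot θ y
    rw [e]
    exact hasDerivAt_rotZ_zero (Z y)
  exact h1.unique h2

/-- The divergence in coordinates: `div Z = (DZ e₁)₁ + (DZ e₂)₂ + (DZ e₃)₃`. [folklore] -/
theorem divergence_eq_three (Z : (EuclideanSpace ℝ (Fin 3)) → (EuclideanSpace ℝ (Fin 3))) (y : (EuclideanSpace ℝ (Fin 3))) :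
    VectorCalculus.divergence Z y =
      fderiv ℝ Z y (EuclideanSpace.single 0 (1 : ℝ)) 0 + fderiv ℝ Z y (EuclideanSpace.single 1 (1 : ℝ)) 1 +
        fderiv ℝ Z y (EuclideanSpace.single 2 (1 : ℝ)) 2 := by
  rw [divergence_eq_sum_inner_fderiv (EuclideanSpace.basisFun (Fin 3) ℝ) Z y, Fin.sum_univ_three]
  simp only [EuclideanSpace.basisFun_apply, EuclideanSpace.inner_single_left, map_one, one_mul]

/-! ### No radial part -/

/-- **A columnar field has no radial part on the half-plane**: `Z₁(r, 0, z) = 0` for all `r`, `z`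
(the ODE `(r Z₁)' = 0` along the ray, see the module docstring). [folklore] -/
theorem radial_eq_zero (hZ : Differentiable ℝ Z) (hdiv : VectorCalculus.IsDivFree Z)
    (hz : ∀ (s : ℝ) (y : (EuclideanSpace ℝ (Fin 3))), Z (y + s • EuclideanSpace.single 2 (1 : ℝ)) = Z y)
    (hrot : ∀ (θ : ℝ) (y : (EuclideanSpace ℝ (Fin 3))), Z (rotZ θ y) = rotZ θ (Z y)) (r z : ℝ) :
    Z (r • EuclideanSpace.single 0 (1 : ℝ) + z • EuclideanSpace.single 2 (1 : ℝ)) 0 = 0 := by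
  -- the ray and the function `f r = r Z₁(ray r)`
  set ray : ℝ → (EuclideanSpace ℝ (Fin 3)) := fun ρ => ρ • EuclideanSpace.single 0 (1 : ℝ) + z • EuclideanSpace.single 2 (1 : ℝ)
    with hray
  have hray0 : ∀ ρ, ray ρ 0 = ρ := fun ρ => by simp [hray]
  have hray1 : ∀ ρ, ray ρ 1 = 0 := fun ρ => by simp [hray]
  -- derivative of `ρ ↦ Z (ray ρ) 0`
  have hcomp : ∀ ρ, HasDerivAt (fun ρ : ℝ => Z (ray ρ) 0)
      (fderiv ℝ Z (ray ρ) (EuclideanSpace.single 0 (1 : ℝ)) 0) ρ := by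
    intro ρ
    have hc : HasDerivAt ray (EuclideanSpace.single 0 (1 : ℝ)) ρ := by
      have h := ((hasDerivAt_id ρ).smul_const (EuclideanSpace.single 0 (1 : ℝ) : (EuclideanSpace ℝ (Fin 3)))).add_const
        (z • (EuclideanSpace.single 2 (1 : ℝ) : (EuclideanSpace ℝ (Fin 3))))
      simpa [hray] using h
    have h1 : HasDerivAt (fun ρ : ℝ => Z (ray ρ)) (fderiv ℝ Z (ray ρ) (EuclideanSpace.single 0 (1 : ℝ))) ρ :=
      (hZ (ray ρ)).hasFDerivAt.comp_hasDerivAt ρ hc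
    exact ((EuclideanSpace.proj (0 : Fin 3) : (EuclideanSpace ℝ (Fin 3)) →L[ℝ] ℝ).hasFDerivAt.comp_hasDerivAt ρ h1)
  -- `ρ (DZ e₂)₂ = Z₁` on the ray (generator identity) and `(DZ e₃) = 0`
  have hgen : ∀ ρ, ρ * fderiv ℝ Z (ray ρ) (EuclideanSpace.single 1 (1 : ℝ)) 1 = Z (ray ρ) 0 := by
    intro ρ
    have key := fderiv_rotGen hZ hrot (ray ρ)
    rw [hray1, hray0, neg_zero, zero_smul, zero_add, map_smul] at key
    have e := congrArg (fun v : (EuclideanSpace ℝ (Fin 3)) => v 1) key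
    simp only [PiLp.smul_apply, smul_eq_mul, PiLp.add_apply, PiLp.single_apply] at e
    simpa using e
  have he3 : ∀ ρ, fderiv ℝ Z (ray ρ) (EuclideanSpace.single 2 (1 : ℝ)) 2 = 0 := fun ρ => by
    rw [fderiv_e3 hZ hz]; rfl
  -- `f' = 0`
  have hf : ∀ ρ, HasDerivAt (fun ρ : ℝ => ρ * Z (ray ρ) 0) 0 ρ := by
    intro ρ
    have h := (hasDerivAt_id ρ).mul (hcomp ρ)
    have hd := hdiv (ray ρ)
    rw [divergence_eq_three, he3 ρ, add_zero] at hd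
    have hval : 1 * Z (ray ρ) 0 + ρ * fderiv ℝ Z (ray ρ) (EuclideanSpace.single 0 (1 : ℝ)) 0 = 0 := by
      have := hgen ρ
      linear_combination (-1 : ℝ) * this + ρ * hd
    have h' : HasDerivAt (fun ρ : ℝ => ρ * Z (ray ρ) 0)
        (1 * Z (ray ρ) 0 + ρ * fderiv ℝ Z (ray ρ) (EuclideanSpace.single 0 (1 : ℝ)) 0) ρ := h
    exact h'.congr_deriv hval
  have hconst := is_const_of_deriv_eq_zero (f := fun ρ : ℝ => ρ * Z (ray ρ) 0)
    (fun ρ => (hf ρ).differentiableAt) (fun ρ => (hf ρ).deriv) r 0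
  simp only [zero_mul] at hconst
  -- conclude: `r Z₁(ray r) = 0`
  rcases eq_or_ne r 0 with hr | hr
  · -- on the axis the horizontal part vanishes
    have hax := horizontal_eq_zero_of_axis hrot (y := ray 0) (by simp [hray0]) (hray1 0)
    rw [hr]
    exact hax.1
  · exact (mul_eq_zero.1 hconst).resolve_left hr

/-! ### The self-convection of a columnar field -/

/-- **On the half-plane the self-convection is centripetal**: at `y = (r, 0, z)`, `r ≠ 0`,
`DZ(y)[Z(y)] = −(Z₂(y)²/r) e₁`. [folklore] -/
theorem convect_halfPlane (hZ : Differentiable ℝ Z) (hdiv : VectorCalculus.IsDivFree Z)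
    (hz : ∀ (s : ℝ) (y : (EuclideanSpace ℝ (Fin 3))), Z (y + s • EuclideanSpace.single 2 (1 : ℝ)) = Z y)
    (hrot : ∀ (θ : ℝ) (y : (EuclideanSpace ℝ (Fin 3))), Z (rotZ θ y) = rotZ θ (Z y)) {r : ℝ} (hr : r ≠ 0) (z : ℝ) :
    fderiv ℝ Z (r • EuclideanSpace.single 0 (1 : ℝ) + z • EuclideanSpace.single 2 (1 : ℝ))
        (Z (r • EuclideanSpace.single 0 (1 : ℝ) + z • EuclideanSpace.single 2 (1 : ℝ))) =
      (-((Z (r • EuclideanSpace.single 0 (1 : ℝ) + z • EuclideanSpace.single 2 (1 : ℝ)) 1) ^ 2 / r)) •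
        EuclideanSpace.single 0 (1 : ℝ) := by
  set y : (EuclideanSpace ℝ (Fin 3)) := r • EuclideanSpace.single 0 (1 : ℝ) + z • EuclideanSpace.single 2 (1 : ℝ) with hy
  have hy0 : y 0 = r := by simp [hy]
  have hy1 : y 1 = 0 := by simp [hy]
  have hZ0 : Z y 0 = 0 := radial_eq_zero hZ hdiv hz hrot r z
  -- `Z y = Z₁ e₂ + Z₂ e₃`
  have hZy : Z y = (Z y 1) • EuclideanSpace.single 1 (1 : ℝ) + (Z y 2) • EuclideanSpace.single 2 (1 : ℝ) := by
    ext i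
    fin_cases i <;> simp [hZ0]
  -- `r DZ(y) e₂ = −Z₁ e₁` (generator identity with `Z₀ = 0`)
  have hgen := fderiv_rotGen hZ hrot y
  rw [hy1, hy0, hZ0, neg_zero, zero_smul, zero_add, zero_smul, add_zero, map_smul] at hgen
  have he2 : fderiv ℝ Z y (EuclideanSpace.single 1 (1 : ℝ)) = (-(Z y 1) / r) • EuclideanSpace.single 0 (1 : ℝ) := by
    have h : r • fderiv ℝ Z y (EuclideanSpace.single 1 (1 : ℝ)) = r • ((-(Z y 1) / r) • EuclideanSpace.single 0 (1 : ℝ)) := by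
      rw [hgen, smul_smul, mul_div_cancel₀ _ hr]
    exact smul_right_injective _ hr h
  have he3 : fderiv ℝ Z y (EuclideanSpace.single 2 (1 : ℝ)) = 0 := fderiv_e3 hZ hz y
  conv_lhs => rw [hZy]
  rw [map_add, map_smul, map_smul, he2, he3, smul_zero, add_zero, smul_smul]
  congr 1
  field_simp

/-- **Equivariance of the self-convection**: `DZ(R_θ y)[Z(R_θ y)] = R_θ (DZ(y)[Z(y)])`. [folklore] -/
theorem convect_rotZ (hZ : Differentiable ℝ Z)
    (hrot : ∀ (θ : ℝ) (y : (EuclideanSpace ℝ (Fin 3))), Z (rotZ θ y) = rotZ θ (Z y)) (θ : ℝ) (y : (EuclideanSpace ℝ (Fin 3))) :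
    fderiv ℝ Z (rotZ θ y) (Z (rotZ θ y)) = rotZ θ (fderiv ℝ Z y (Z y)) := by
  -- `Z ∘ R_θ = R_θ ∘ Z`, differentiate both sides at `y`
  have h1 : HasFDerivAt (fun w : (EuclideanSpace ℝ (Fin 3)) => Z (rotZ θ w)) ((fderiv ℝ Z (rotZ θ y)).comp (rotZL θ)) y :=
    (hZ (rotZ θ y)).hasFDerivAt.comp y (rotZL θ).hasFDerivAt
  have h2 : HasFDerivAt (fun w : (EuclideanSpace ℝ (Fin 3)) => Z (rotZ θ w)) ((rotZL θ).comp (fderiv ℝ Z y)) y := by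
    have e : (fun w : (EuclideanSpace ℝ (Fin 3)) => Z (rotZ θ w)) = fun w => rotZL θ (Z w) := funext fun w => hrot θ w
    rw [e]
    exact (rotZL θ).hasFDerivAt.comp y (hZ y).hasFDerivAt
  have heq := h1.unique h2
  have := congrArg (fun T : (EuclideanSpace ℝ (Fin 3)) →L[ℝ] (EuclideanSpace ℝ (Fin 3)) => T (Z y)) heq
  simp only [ContinuousLinearMap.comp_apply, rotZL_apply] at this
  rw [← hrot θ y] at this
  exact this

/-- The self-convection does not depend on `x₃` (neither does `Z`). [folklore] -/
theorem convect_add_e3 (hz : ∀ (s : ℝ) (y : (EuclideanSpace ℝ (Fin 3))), Z (y + s • EuclideanSpace.single 2 (1 : ℝ)) = Z y)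
    (s : ℝ) (y : (EuclideanSpace ℝ (Fin 3))) :
    fderiv ℝ Z (y + s • EuclideanSpace.single 2 (1 : ℝ)) (Z (y + s • EuclideanSpace.single 2 (1 : ℝ))) =
      fderiv ℝ Z y (Z y) := by
  have e : Z = fun w => Z (w + s • EuclideanSpace.single 2 (1 : ℝ)) := funext fun w => (hz s w).symm
  have h : fderiv ℝ Z y = fderiv ℝ Z (y + s • EuclideanSpace.single 2 (1 : ℝ)) := by
    conv_lhs => rw [e]
    rw [fderiv_comp_add_right]
  rw [hz, h]

/-- **The self-convection off the axis**: `DZ(y)[Z(y)] = −(Z₂(r e₁)²/r²) (y − y₃e₃)` with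
`r = |y_h| ≠ 0` (rotate the half-plane formula). [folklore] -/
theorem convect_formula (hZ : Differentiable ℝ Z) (hdiv : VectorCalculus.IsDivFree Z)
    (hz : ∀ (s : ℝ) (y : (EuclideanSpace ℝ (Fin 3))), Z (y + s • EuclideanSpace.single 2 (1 : ℝ)) = Z y)
    (hrot : ∀ (θ : ℝ) (y : (EuclideanSpace ℝ (Fin 3))), Z (rotZ θ y) = rotZ θ (Z y)) {y : (EuclideanSpace ℝ (Fin 3))} (hy : cylRadius y ≠ 0) :
    fderiv ℝ Z y (Z y) =
      (-((Z (cylRadius y • EuclideanSpace.single 0 (1 : ℝ)) 1) ^ 2 / (cylRadius y) ^ 2)) •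
        (y - (y 2) • EuclideanSpace.single 2 (1 : ℝ)) := by
  obtain ⟨θ, hθ⟩ := exists_rotZ_eq_single_add_smul y
  set r : ℝ := cylRadius y with hr
  set w : (EuclideanSpace ℝ (Fin 3)) := r • EuclideanSpace.single 0 (1 : ℝ) + (y 2) • EuclideanSpace.single 2 (1 : ℝ) with hw
  have hθ' : rotZ θ y = w := by
    rw [hθ, hw, add_comm]
    congr 1
    ext i; fin_cases i <;> simp
  -- `y = R_{-θ} w` and `R_{-θ} e₁ = (y - y₃ e₃)/r`
  have hyw : y = rotZ (-θ) w := by rw [← hθ', ← rotZ_add, neg_add_cancel, rotZ_zero]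
  have hconv_w := convect_halfPlane hZ hdiv hz hrot hy (y 2)
  -- `Z₂(w) = Z₂(r e₁)` by `x₃`-independence
  have hZw1 : Z w 1 = Z (r • EuclideanSpace.single 0 (1 : ℝ)) 1 := by
    rw [hw, hz]
  -- rotate
  have key := convect_rotZ hZ hrot (-θ) w
  rw [← hyw] at key
  rw [key, hconv_w, ← rotZL_apply, map_smul, rotZL_apply, hZw1]
  -- `R_{-θ} e₁ = r⁻¹ (y − y₃ e₃)`
  have hdir : rotZ (-θ) (EuclideanSpace.single 0 (1 : ℝ)) = r⁻¹ • (y - (y 2) • EuclideanSpace.single 2 (1 : ℝ)) := by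
    have h1 : rotZ (-θ) w = r • rotZ (-θ) (EuclideanSpace.single 0 (1 : ℝ)) + (y 2) • EuclideanSpace.single 2 (1 : ℝ) := by
      rw [hw, ← rotZL_apply, map_add, map_smul, map_smul, rotZL_apply, rotZL_apply, rotZ_smul_single']
    rw [← hyw] at h1
    have h2 : r • rotZ (-θ) (EuclideanSpace.single 0 (1 : ℝ)) = y - (y 2) • EuclideanSpace.single 2 (1 : ℝ) := by
      rw [eq_sub_iff_add_eq]; exact h1.symm
    rw [← h2, smul_smul, inv_mul_cancel₀ hy, one_smul]
  rw [hdir, smul_smul]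
  congr 1
  field_simp
where
  /-- `R_θ e₃ = e₃` (axial unit vector). -/
  rotZ_smul_single' : ∀ θ : ℝ, rotZ θ (EuclideanSpace.single 2 (1 : ℝ) : (EuclideanSpace ℝ (Fin 3))) = EuclideanSpace.single 2 (1 : ℝ) :=
    fun θ => by ext i; fin_cases i <;> simp [rotZ]

/-- **On the axis the self-convection vanishes** (`Z = Z₃ e₃` there and `∂₃Z = 0`). [folklore] -/
theorem convect_axis (hZ : Differentiable ℝ Z)
    (hz : ∀ (s : ℝ) (y : (EuclideanSpace ℝ (Fin 3))), Z (y + s • EuclideanSpace.single 2 (1 : ℝ)) = Z y)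
    (hrot : ∀ (θ : ℝ) (y : (EuclideanSpace ℝ (Fin 3))), Z (rotZ θ y) = rotZ θ (Z y)) {y : (EuclideanSpace ℝ (Fin 3))} (hy : cylRadius y = 0) :
    fderiv ℝ Z y (Z y) = 0 := by
  obtain ⟨h0, h1⟩ := (cylRadius_eq_zero_iff y).1 hy
  obtain ⟨hZ0, hZ1⟩ := horizontal_eq_zero_of_axis hrot h0 h1
  have hZy : Z y = (Z y 2) • EuclideanSpace.single 2 (1 : ℝ) := by
    ext i; fin_cases i <;> simp [hZ0, hZ1]
  rw [hZy, map_smul, fderiv_e3 hZ hz y, smul_zero]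

end Columnar

end Summit.NavierStokesRegularity.NavierStokesRegularity.Theorems.ScenarioCensus.PitchDefect

end
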